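import Summits.BirchSwinnertonDyer.BirchSwinnertonDyer.Theorems.PrintCFramBottomClassIndexLawFiveLeKrizLiBindersAnchorBase
import Summits.BirchSwinnertonDyer.BirchSwinnertonDyer.Theorems.PrintCFramBottomClassIndexLawFiveLeKrizLiLocusKolyvagin
import Summits.BirchSwinnertonDyer.BirchSwinnertonDyer.Theorems.PrintCFramBottomClassIndexLawFiveLeEisensteinTraceFormClass
import Literature.NumberTheory.EllipticCurves.IsogenyIdProofs
import Mathlib.Tactic.NormNum.LegendreSymbol
import HarnessLib

/-!
# Crux `PrintCFram.BottomClassIndexLawFiveLe` (stmt-BirchSwinnertonDyer-20372), line `eisenstein-resource-bdp-line`: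
# THE ANCHOR `(A(11), p = 11, K'' = ℚ(√−7))` — two Bernoulli-unit certificates (`‖B_{1,ω^{7}}‖_{11} = 1`,
# `‖B_{1,χ_{−7}ω^{2}}‖_{11} = 1`, tables checked by the kernel) and hence the Kriz–Li CHARACTER ∧ `ε_K` ∧ BERNOULLI-(4) block and
# the END STATE «prints ∧ KL ∧ Heegner data over ℚ(√−7) ∧ UPPER ⟹ C2's conclusion» for every globally minimal rank-one `W ∼ A(11)`
# (cell `bsd-print-cfram`, width seat `bsd-line-cfram-p1-w3` g2; THEOREMS ONLY, `--supports` 20372; BSD is not proved by any of this)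

HONEST FRAMING. Nothing here proves BSD or closes a stub. `A(11)` (`cm11`, `j = -32768`) is the base curve of the leaf class at
`p = 11`; it has analytic rank one (`11 ≡ 3 (mod 8)`, Gross). Its Eisenstein pair is `(ω^{3}, ω^{8})` (w2 g2's `lFunction_cm11_mod`), so
`ψ = ω^{3}` is the ODD member, `ψ⁻¹ = ω^{7}` (class factor) and `ψε_Kω⁻¹ = χ_{−7}ω^{2}` (`K''`-factor) for the Heegner field
`ℚ(√−7)` (`11` splits there; `7` is the least admissible prime with both Bernoulli numbers `11`-adic units — local search, seconds).
Certificates follow w2's `AnchorBernoulli163(Twin)` template (`decide +kernel` on tables of `j^{p·a} mod p²`); the block and the END STATE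
follow `…KrizLiBindersAnchorBase` / `…Anchor163EndState`. What remains at this anchor: Heegner data `(Dt, H, P)` over `K''`,
`L(A(11)^{(−7)}, 1) ≠ 0`, and the Kolyvagin UPPER half (resp. regularity). beyond-print theorem: NO.
References: [KrizLi2019] Thm. 1.20, Rem. 1.21; [Washington1997] §5.1, Thm. 4.2; [Gross1980] §22; [Rubin1983] Thm. C.
-/

noncomputable section

-- summit-side namespace `Summit.BirchSwinnertonDyer.BirchSwinnertonDyer.…` (single-conjunct summit, D-0017 layout)
set_option linter.dupNamespace false

open scoped Classical NumberTheorySymbols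

namespace Summit.BirchSwinnertonDyer.BirchSwinnertonDyer.Theorems.PrintCFram.KrizLiBinders

open WeierstrassCurve NumberField IsDedekindDomain Field PowerSeries DirichletCharacter
  Literature.NumberTheory.EllipticCurves Literature.NumberTheory.EllipticCurves.GreenbergSelmer
  Literature.NumberTheory.EllipticCurves.GreenbergVatsal2000
  Literature.NumberTheory.EllipticCurves.ModularForms
  Literature.NumberTheory.EllipticCurves.KrizLi2019 Literature.NumberTheory.LFunctions
  Literature.NumberTheory.GaloisCohomology
  Literature.NumberTheory.EllipticCurves.Rank1Residual
  Literature.NumberTheory.EllipticCurves.Rank1Residual.Typed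
  Literature.NumberTheory.GaloisRepresentations
  Summit.BirchSwinnertonDyer.Rank1Residual
  Summit.BirchSwinnertonDyer.Rank1Residual.Additive
  Summit.BirchSwinnertonDyer.Rank1Residual.X11b Summit.BirchSwinnertonDyer.Rank1Residual.X11b.AcSelmer
  Summit.BirchSwinnertonDyer.Rank1Residual.X11b.Halves
  Summit.BirchSwinnertonDyer.Rank1Residual.X12 Summit.BirchSwinnertonDyer.Rank1Residual.X12.O11
  Summit.BirchSwinnertonDyer.Rank1Residual.X2.ResidualDevissageModules
  Summit.BirchSwinnertonDyer.BirchSwinnertonDyer.Theses.UniversalToricDescent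
  Summit.BirchSwinnertonDyer.BirchSwinnertonDyer.Theorems
  Summit.BirchSwinnertonDyer.BirchSwinnertonDyer.Theorems.SchneiderFree

/-! ## §1 The class factor `‖B_{1,ω^{7}}‖_{11} = 1` -/

/-- The table `t(j) = j^{11·7} mod 11²`, `0 < j < 11`, checked by the kernel. [folklore] -/
theorem teichmullerPowTable_11_7 : ∀ j, j < 11 → j ≠ 0 →
    j ^ (11 * 7) ≡ ((
    [0, 1, 40, 9, 27, 3, 118, 94, 112, 81, 120] : List ℕ).getD j 0) [MOD 11 ^ 2] := by
  decide +kernel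

/-- The certificate sum `S = Σ t(j)·j = 4422` has `11 ∣ S`, `11² ∤ S`, checked by the kernel. [folklore] -/
theorem certSum_11_7 :
    ((11 : ℕ) : ℤ) ∣ ∑ j : ZMod 11, (((
    [0, 1, 40, 9, 27, 3, 118, 94, 112, 81, 120] : List ℕ).getD j.val 0 : ℕ) : ℤ) * (j.val : ℤ) ^ (0 + 1) ∧
    ¬ ((11 : ℕ) : ℤ) ^ 2 ∣ ∑ j : ZMod 11, (((
    [0, 1, 40, 9, 27, 3, 118, 94, 112, 81, 120] : List ℕ).getD j.val 0 : ℕ) : ℤ) * (j.val : ℤ) ^ (0 + 1) := by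
  constructor
  · decide +kernel
  · decide +kernel

/-- **`‖B_{1,ω^{7}}‖_{11} = 1`** for every Teichmüller character `ω` mod `11` (equivalently `11 ∤ B_{8}`): the class factor of
Kriz–Li's (4) at `A(11)` (`ψ⁻¹ = ω^{7}`). [cite: Washington1997, §5.1 and Thm. 4.2] [cite: KrizLi2019, Thm. 1.20 (p. 8)] -/
theorem norm_bernoulliOnePrim_teichmuller_pow_7_p11 [Fact (Nat.Prime 11)]
    (ω : DirichletCharacter ℚ_[11] 11) (hω : IsTeichmullerCharacter ω) :
    ‖bernoulliOnePrim (ω ^ 7)‖ = 1 :=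
  AnchorReduction.norm_bernoulliOnePrim_teichmuller_pow_of_table ω hω (by norm_num)
    (teichmuller_pow_ne_one hω (by norm_num) (by norm_num)) (fun j => (
    [0, 1, 40, 9, 27, 3, 118, 94, 112, 81, 120] : List ℕ).getD j 0) rfl teichmullerPowTable_11_7 certSum_11_7.1 certSum_11_7.2

/-! ## §2 The `K''`-factor `‖B_{1,χ_{−7}·ω^{2}}‖_{11} = 1` -/

/-- The table `t(j) = j^{11·2} mod 11²`, `0 < j < 11`, checked by the kernel. [folklore] -/
theorem teichmullerPowTable_11_2 : ∀ j, j < 11 → j ≠ 0 →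
    j ^ (11 * 2) ≡ ((
    [0, 1, 81, 9, 27, 3, 3, 27, 9, 81, 1] : List ℕ).getD j 0) [MOD 11 ^ 2] := by
  decide +kernel

/-- `ord_{11}(11·7) = 1`. [folklore] -/
theorem padicValNat_11_mul_7 : padicValNat 11 (11 * 7) = 1 := by
  haveI : Fact (Nat.Prime 11) := ⟨by norm_num⟩
  rw [padicValNat.mul (by norm_num) (by norm_num), padicValNat_self, padicValNat.eq_zero_of_not_dvd (by norm_num)]

/-- The certificate sum `S = Σ_{j mod 77} (j/7)·t(j mod 11)·j = -3696` has `11 ∣ S`, `11² ∤ S`, checked by the kernel. [folklore] -/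
theorem certSum_11_2_7 :
    ((11 : ℕ) : ℤ) ∣ ∑ j : ZMod (11 * 7), (legendreSym 7 (j.val : ℤ) * (((
    [0, 1, 81, 9, 27, 3, 3, 27, 9, 81, 1] : List ℕ).getD (j.val % 11) 0 : ℕ) : ℤ)) * (j.val : ℤ) ^ (0 + 1) ∧
    ¬ ((11 : ℕ) : ℤ) ^ 2 ∣ ∑ j : ZMod (11 * 7), (legendreSym 7 (j.val : ℤ) * (((
    [0, 1, 81, 9, 27, 3, 3, 27, 9, 81, 1] : List ℕ).getD (j.val % 11) 0 : ℕ) : ℤ)) * (j.val : ℤ) ^ (0 + 1) := by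
  constructor
  · decide +kernel
  · decide +kernel

set_option maxRecDepth 40000 in
/-- **`‖B_{1,χ_{−7}·ω^{2}}‖_{11} = 1`**: for every Teichmüller `ω` mod `11` and every `ℚ_11`-valued `θ` mod `77 = 11·7` with values
`θ(j) = (j/7)·ω(j)^{2}`, `B_{1,θ}` is a `11`-adic unit — the `K''`-factor of Kriz–Li's (4) at `(A(11), ℚ(√−7))` (`ψε_Kω⁻¹ = χ_{−7}ω^{2}`,
`2 = (11−3)/4`). `θ ≠ 1` by `θ(12) = (5/7)·ω(1)^{2} = −1`. [cite: KrizLi2019, Thm. 1.20 (p. 8)] [cite: Rubin1983, §0 Thm. C] [cite: Washington1997, Thm. 4.2] -/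
theorem norm_generalizedBernoulli_theta2_A11 [Fact (Nat.Prime 11)]
    (ω : DirichletCharacter ℚ_[11] 11) (hω : IsTeichmullerCharacter ω) (θ : DirichletCharacter ℚ_[11] (11 * 7))
    (hθ : ∀ j : ZMod (11 * 7), θ j = (legendreSym 7 (j.val : ℤ) : ℚ_[11]) * ω (j.val : ZMod 11) ^ 2) :
    ‖generalizedBernoulli 1 θ‖ = 1 := by
  have hθ1 : θ ≠ 1 := by
    intro h
    have hA := hθ ((12 : ℕ) : ZMod (11 * 7))
    have hv : (((12 : ℕ) : ZMod (11 * 7))).val = 12 := by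
      rw [ZMod.val_natCast]
    have hu : IsUnit (((12 : ℕ) : ZMod (11 * 7))) :=
      (ZMod.isUnit_iff_coprime 12 (11 * 7)).mpr (by norm_num)
    have h1 : ((12 : ℕ) : ZMod 11) = 1 := by
      rw [show (12 : ℕ) = 11 * 1 + 1 from rfl, Nat.cast_add, Nat.cast_mul, ZMod.natCast_self, zero_mul, zero_add,
        Nat.cast_one]
    have hleg : legendreSym 7 ((12 : ℕ) : ℤ) = -1 := by
      rw [legendreSym.mod]; norm_num
    rw [h, MulChar.one_apply hu, hv, h1, map_one, one_pow, mul_one, hleg] at hA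
    norm_num at hA
  exact AnchorReduction.norm_generalizedBernoulli_legendre_teichmullerPow_of_cert ω hω (by norm_num) padicValNat_11_mul_7 θ hθ1 hθ
    (fun j => (
    [0, 1, 81, 9, 27, 3, 3, 27, 9, 81, 1] : List ℕ).getD j 0) rfl teichmullerPowTable_11_2 certSum_11_2_7.1 certSum_11_2_7.2

/-! ## §3 The block and the END STATE at `(A(11), 11, ℚ(√−7))` -/

/-- **The Kriz–Li character ∧ `ε_K` ∧ Bernoulli block at `(A(11), 11, K'')` for every quadratic field `K''` of discriminant `−7`**:
for every `W ∼ A(11)`: `∃ f ψ ω εK`, `ψ.IsPrimitive ∧ IsTeichmullerCharacter ω ∧ hss ∧ (1) ∧ (3) ∧ IsKroneckerCharacterOf K'' εK ∧ (4) ∧ ψ.Odd`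
(`ψ = ω^{3}`). [cite: KrizLi2019, Thm. 1.20 (pp. 7–8), Rem. 1.21, §2 (p. 12)] [cite: Mazur1978, Prop. 6.3 (1) (p. 153)] -/
theorem exists_krizLiCharacterBlock_A11 [Fact (Nat.Prime 11)] (W : WeierstrassCurve ℚ) [W.IsElliptic]
    (hiso : IsIsogenous W cm11) (K : Type) [Field K] [NumberField K] (hK2 : Module.finrank ℚ K = 2)
    (hdK : NumberField.discr K = -7) [NeZero (NumberField.discr K).natAbs] :
    ∃ (f : ℕ) (_ : NeZero f) (ψ : DirichletCharacter ℚ_[11] f) (ω : DirichletCharacter ℚ_[11] 11)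
      (εK : DirichletCharacter ℚ_[11] (NumberField.discr K).natAbs),
      ψ.IsPrimitive ∧ IsTeichmullerCharacter ω ∧
      (∀ ℓ : ℕ, ℓ.Prime → ¬ (ℓ ∣ 11 * W.conductorNorm ℤ) →
        ‖((W.LFunction ℓ : ℤ) : ℚ_[11]) - (ψ (ℓ : ZMod f) + ψ⁻¹ (ℓ : ZMod f) * ω (ℓ : ZMod 11))‖ < 1) ∧
      (ψ ((11 : ℕ) : ZMod f) ≠ 1 ∧ primVal (invMulOmega ψ ω) 11 ≠ 1) ∧
      (∀ ℓ : ℕ, (hℓ : ℓ.Prime) → ℓ ≠ 11 →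
        (haveI := Fact.mk hℓ; ¬ W.HasGoodReductionAtPrime ℓ ∧ ¬ W.HasMultiplicativeReductionAtPrime ℓ) →
        ψ (ℓ : ZMod f) ≠ 1 ∧ primVal (invMulOmega ψ ω) ℓ ≠ 1) ∧
      IsKroneckerCharacterOf K εK ∧
      ¬ (‖bernoulliOnePrim (bernoulliCharOne ψ εK) * bernoulliOnePrim (bernoulliCharTwo ψ εK ω)‖ ≤ ((11 : ℕ) : ℝ)⁻¹) ∧
      ψ.Odd := by
  exact exists_krizLiCharacterBlock_base (p := 11) (by norm_num) cm11 (k := 3) (by norm_num) (by norm_num) (by decide)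
    (fun r _ h => EisensteinTraceForm.hasGoodReductionAtPrime_cm11 r h) (fun ℓ _ h => by simpa using EisensteinTraceForm.lFunction_cm11_mod ℓ h) W hiso
    (q := 7) (by norm_num) (by norm_num) K hK2 (by rw [hdK]; norm_num)
    (fun ω hω => norm_bernoulliOnePrim_teichmuller_pow_7_p11 ω hω)
    (fun ω hω θ hθ => norm_generalizedBernoulli_theta2_A11 ω hω θ hθ)

/-- **Heegner hypothesis for `(N_W, K'')` at the anchor `A(11)`**: the only bad prime of `W ∼ A(11)` is `11`, which splits in every quadratic
field of discriminant `−7` (`(−7/11) = +1`). [cite: GrossLMS1991, §1 (p. 235)] [cite: Cox2013, §1.C (1.18)] -/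
theorem satisfiesHeegnerHypothesis_A11 [Fact (Nat.Prime 11)] (W : WeierstrassCurve ℚ) [W.IsElliptic]
    (hiso : IsIsogenous W cm11) (K : Type) [Field K] [NumberField K] (hK2 : Module.finrank ℚ K = 2)
    (hdK : NumberField.discr K = -7) :
    SatisfiesHeegnerHypothesis (W.conductorNorm ℤ) K := by
  intro ℓ hℓ hℓN
  haveI := Fact.mk hℓ
  have hℓp : ℓ = 11 := by
    by_contra hne
    exact not_dvd_conductorNorm_of_hasGoodReductionAtPrime W
      ((hiso.hasGoodReductionAtPrime_iff ℓ).mpr (EisensteinTraceForm.hasGoodReductionAtPrime_cm11 ℓ hne)) hℓN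
  subst hℓp
  rw [Literature.NumberTheory.QuadraticFields.Quadratic.ncard_primesOver_eq_two_iff_legendreSym hK2 (by norm_num), hdK]
  norm_num

/-- **END STATE at the anchor `A(11)`, Kolyvagin form** (LEAD g6's Kriz–Li-datum theorem with the twelve character-side hypotheses
discharged and the Heegner hypothesis automatic): for every globally minimal rank-one `W ∼ A(11)` (CM, `11` CM-ramified), every imaginary
quadratic `K''` with `d_{K''} = −7`, Heegner data `(Dt, H, ι, P)` at level `N_W` with `L(W^{(−7)},1) ≠ 0`, and the finite-level Kolyvagin
UPPER inequality at that datum: `RamifiedCMBottomClassIndexLawAtZp W 11` — conditional on the seven citations and Kriz–Li Thm. 1.20 only.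
[cite: KrizLi2019, Thm. 1.20 (pp. 7–8), Rem. 1.21 (p. 8)] [cite: GrigorovJorzaPatrikisSteinTarnita2009, Thm. 3.7] -/
theorem ramifiedCMBottomClassIndexLawAtZp_A11_of_indexUpper [Fact (Nat.Prime 11)]
    (hprints : Hsieh2014.thmA_exists_isHsiehLFunction_unrPeriod_anyLevel ∧
      LiuZhangZhang2018.thm151_thm153_modularCurve_heegnerVector_additive ∧
      ToricPublishedInputs ∧
      (∀ (K : Type) [Field K] [NumberField K], poitouTate_sha_tateDual K) ∧
      bsdTriple_of_hasCM_of_L_one_ne_zero ∧ hasEntireLFunction_rat ∧ bsdRHS_eq_of_isIsogenous)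
    (hKL : KrizLi2019.thm120_padicLogHeegner_unit_of_bernoulli)
    (W : WeierstrassCurve ℚ) [W.IsElliptic] [W.IsGloballyMinimal] (hCM : W.HasCM) (hram : CMRamified W 11)
    (hiso : IsIsogenous W cm11) (hr : W.analyticRank = 1) [NeZero (W.conductorNorm ℤ)]
    (K : Type) [Field K] [NumberField K] [NeZero (NumberField.discr K).natAbs]
    (Dt : ModularParametrizationData W (W.conductorNorm ℤ)) (H : HeegnerDatum (W.conductorNorm ℤ) (NumberField.discr K))
    (ι : K →+* ℂ) (P : (W.baseChange K).toAffine.Point)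
    (hK : IsImaginaryQuadratic K) (hdK : NumberField.discr K = -7)
    (hLt : (W.quadraticTwist (NumberField.discr K : ℚ)).entireLFunction 1 ≠ 0)
    (hP : WeierstrassCurve.Affine.Point.map ι.toRatAlgHom P = heegnerPointComplex Dt H)
    (hup : ¬ IsOfFinAddOrder P → Upper.IndexUpperBoundLeAt W 11 K P (padicValNat 11 Dt.c.natAbs)) :
    X12.O11.RamifiedCMBottomClassIndexLawAtZp W 11 := by
  obtain ⟨f, hf, ψ, ω, εK, hψ, hω, hss, ⟨h1, h1'⟩, h3, hεK, h4, -⟩ :=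
    exists_krizLiCharacterBlock_A11 W hiso K hK.1 hdK
  haveI := hf
  have hodd : Odd (NumberField.discr K) := by rw [hdK]; decide
  have hd4 : NumberField.discr K < -4 := by rw [hdK]; norm_num
  exact KrizLiKolyvagin.ramifiedCMBottomClassIndexLawAtZp_of_krizLiDatum_of_indexUpper hprints hKL W hCM hram (by norm_num) hr
    (W.conductorNorm ℤ) K Dt H ι P rfl hK (satisfiesHeegnerHypothesis_A11 W hiso K hK.1 hdK) hodd hd4 hLt hP f ψ ω hψ hω hss
    h1 h1' h3 εK hεK h4 hup

end Summit.BirchSwinnertonDyer.BirchSwinnertonDyer.Theorems.PrintCFram.KrizLiBinders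

end
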